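import Mathlib.RingTheory.Valuation.ValuationSubring
import Mathlib.Algebra.Order.GroupWithZero.Basic
import Mathlib.Data.Nat.Find
import Mathlib.Algebra.BigOperators.Fin
import Mathlib.RingTheory.Algebraic.Basic
import Mathlib.Algebra.Polynomial.AlgebraMap
import HarnessLib

/-!
# A maximal family with multiplicatively independent values ("a basis of `V K ⊗_ℤ ℚ`")

Topic: `Literature/AlgebraicGeometry/Resolution`. PROOF side of `CossartPiltant2019ReductionP`
(`ArithmeticalThreefoldsLocal.lean`), input (C4), [CoP1] Prop. 8.1 / Prop. 9.3 (V. Cossart,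
O. Piltant, HAL hal-00139124, pp. 22, 27): "We pick elements `f₁, …, f_r ∈ m_{S₀}` such that
`W f₁, …, W f_r` are linearly independent in `W L ⊗_ℤ ℚ`" (p. 22), "We now pick
`f₁, …, f_r ∈ R₁` such that `(V f₁, …, V f_r)` form a basis of `V K ⊗_ℤ ℚ`" (p. 27), `r` being
the rational rank of the valuation. In the tree the rational rank is not used as a number;
instead this file PROVES the existence of such a choice in elementary multiplicative form
(`exists_maximal_independent_family`): inside any set `B` of elements (e.g. a subring), given
a bound `N` on the size of families from `B` with multiplicatively independent values and one
element of `B` of value in `(0, 1)`, there are `0 < r ≤ N` elements `g₁, …, g_r ∈ B` with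
independent values such that the value of every nonzero element of `B` is rationally dependent
on them (`v(y)ⁿ ∏ v(gᵢ)^{bᵢ} = ∏ v(gᵢ)^{aᵢ}`, `n > 0`). (The bound `N = 3` is Abhyankar's
inequality / monomialization in a local uniformization; it is an input here.)

Everything is PROVED; no named facts, definitions, instances or notation are introduced.

## Sources

* V. Cossart, O. Piltant, J. Algebra 320 (2008) 1051–1082: proofs of Prop. 8.1 and Prop. 9.3
  (HAL hal-00139124, pp. 22, 27). [CossartPiltant2008]
-/

namespace Literature.AlgebraicGeometry.Resolution

open Function

section MaximalFamily

variable {E : Type*} [Field E] (O : ValuationSubring E)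

set_option maxHeartbeats 800000 in
/-- **A maximal family with independent values** ([CoP1] proof of Prop. 9.3: "pick
`f₁, …, f_r ∈ R₁` such that `(V f₁, …, V f_r)` form a basis of `V K ⊗_ℤ ℚ`"), in
multiplicative form: see the module docstring.
[cite: CossartPiltant2008, proof of Prop. 9.3 (HAL p. 27)] -/
theorem exists_maximal_independent_family (B : Set E) (N : ℕ)
    (hbound : ∀ (k : ℕ) (y : Fin k → E), (∀ i, y i ∈ B) → (∀ i, y i ≠ 0) →
      (∀ p m : Fin k → ℕ, ∏ i, O.valuation (y i) ^ p i = ∏ i, O.valuation (y i) ^ m i → p = m) →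
      k ≤ N)
    (hne : ∃ y ∈ B, y ≠ 0 ∧ O.valuation y < 1) :
    ∃ (r : ℕ) (g : Fin r → E), 0 < r ∧ r ≤ N ∧ (∀ i, g i ∈ B) ∧ (∀ i, g i ≠ 0) ∧
      (∀ p m : Fin r → ℕ, ∏ i, O.valuation (g i) ^ p i = ∏ i, O.valuation (g i) ^ m i → p = m) ∧
      ∀ y ∈ B, y ≠ 0 → ∃ (n : ℕ) (a b : Fin r → ℕ), 0 < n ∧
        O.valuation y ^ n * ∏ i, O.valuation (g i) ^ b i = ∏ i, O.valuation (g i) ^ a i := by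
  classical
  let Q : ℕ → Prop := fun k => ∃ y : Fin k → E, (∀ i, y i ∈ B) ∧ (∀ i, y i ≠ 0) ∧
    ∀ p m : Fin k → ℕ, ∏ i, O.valuation (y i) ^ p i = ∏ i, O.valuation (y i) ^ m i → p = m
  -- one element of value in `(0, 1)` is an independent family
  obtain ⟨y₀, hy₀B, hy₀0, hy₀1⟩ := hne
  have hv0 : 0 < O.valuation y₀ :=
    zero_lt_iff.mpr fun h => hy₀0 ((Valuation.zero_iff _).mp h)
  have hQ1 : Q 1 := by
    refine ⟨fun _ => y₀, fun _ => hy₀B, fun _ => hy₀0, fun p m hpm => ?_⟩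
    rw [Fin.prod_univ_one, Fin.prod_univ_one] at hpm
    have h := (pow_right_strictAnti₀ hv0 hy₀1).injective hpm
    funext i
    rw [Subsingleton.elim i 0]
    exact h
  obtain ⟨y₁, hy₁B, hy₁0, hy₁ind⟩ := hQ1
  have h1N : 1 ≤ N := hbound 1 y₁ hy₁B hy₁0 hy₁ind
  -- the largest size of an independent family from `B`
  obtain ⟨g, hgB, hg0, hgind⟩ : Q (Nat.findGreatest Q N) :=
    Nat.findGreatest_spec h1N ⟨y₁, hy₁B, hy₁0, hy₁ind⟩
  refine ⟨Nat.findGreatest Q N, g, Nat.le_findGreatest h1N ⟨y₁, hy₁B, hy₁0, hy₁ind⟩,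
    Nat.findGreatest_le N, hgB, hg0, hgind, fun y hyB hy0 => ?_⟩
  -- maximality: `(y, g)` is not independent
  by_contra hdep
  push Not at hdep
  have hvy0 : O.valuation y ≠ 0 := fun h => hy0 ((Valuation.zero_iff _).mp h)
  let yg : Fin (Nat.findGreatest Q N + 1) → E := Fin.cons (α := fun _ => E) y g
  have hyg0 : yg 0 = y := Fin.cons_zero _ _
  have hygs : ∀ j, yg (Fin.succ j) = g j := fun j => Fin.cons_succ _ _ _
  have hind' : ∀ p m : Fin (Nat.findGreatest Q N + 1) → ℕ,
      ∏ i, O.valuation (yg i) ^ p i = ∏ i, O.valuation (yg i) ^ m i → p = m := by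
    intro p m hpm
    rw [Fin.prod_univ_succ, Fin.prod_univ_succ] at hpm
    simp only [hyg0, hygs] at hpm
    rcases Nat.lt_trichotomy (p 0) (m 0) with hlt | heq | hgt
    · exfalso
      refine hdep (m 0 - p 0) (fun i => p i.succ) (fun i => m i.succ) (Nat.sub_pos_of_lt hlt) ?_
      have : O.valuation y ^ m 0 = O.valuation y ^ p 0 * O.valuation y ^ (m 0 - p 0) := by
        rw [← pow_add, Nat.add_sub_cancel' hlt.le]
      rw [this, mul_assoc] at hpm
      exact (mul_left_cancel₀ (pow_ne_zero _ hvy0) hpm).symm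
    · rw [heq] at hpm
      have htail := hgind _ _ (mul_left_cancel₀ (pow_ne_zero _ hvy0) hpm)
      funext i
      refine Fin.cases ?_ (fun j => ?_) i
      · exact heq
      · exact congr_fun htail j
    · exfalso
      refine hdep (p 0 - m 0) (fun i => m i.succ) (fun i => p i.succ) (Nat.sub_pos_of_lt hgt) ?_
      have : O.valuation y ^ p 0 = O.valuation y ^ m 0 * O.valuation y ^ (p 0 - m 0) := by
        rw [← pow_add, Nat.add_sub_cancel' hgt.le]
      rw [this, mul_assoc] at hpm
      exact mul_left_cancel₀ (pow_ne_zero _ hvy0) hpm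
  have hygB : ∀ i, yg i ∈ B := fun i => by
    refine Fin.cases ?_ (fun j => ?_) i
    · rw [hyg0]; exact hyB
    · rw [hygs]; exact hgB j
  have hyg0' : ∀ i, yg i ≠ 0 := fun i => by
    refine Fin.cases ?_ (fun j => ?_) i
    · rw [hyg0]; exact hy0
    · rw [hygs]; exact hg0 j
  have hQ' : Q (Nat.findGreatest Q N + 1) := ⟨yg, hygB, hyg0', hind'⟩
  have hle : Nat.findGreatest Q N + 1 ≤ N := hbound _ yg hygB hyg0' hind'
  exact Nat.findGreatest_is_greatest (Nat.lt_succ_self _) hle hQ'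

end MaximalFamily

section Algebraic

variable {E : Type*} [Field E] (O : ValuationSubring E) {S : Type*} [CommRing S] [Algebra S E]

omit O in
/-- Product bookkeeping: `(∏ v(gᵢ)^{cᵢ}) (∏ v(gᵢ)^{c′ᵢ}) = ∏ v(gᵢ)^{cᵢ + c′ᵢ}`. [folklore] -/
private theorem prod_pow_mul_prod_pow {Γ : Type*} [CommMonoid Γ] {r : ℕ} (G : Fin r → Γ)
    (c c' : Fin r → ℕ) :
    (∏ i, G i ^ c i) * (∏ i, G i ^ c' i) = ∏ i, G i ^ (c i + c' i) := by
  rw [← Finset.prod_mul_distrib]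
  exact Finset.prod_congr rfl fun i _ => (pow_add _ _ _).symm

omit O in
/-- Product bookkeeping: `(∏ v(gᵢ)^{cᵢ})ⁿ = ∏ v(gᵢ)^{n cᵢ}`. [folklore] -/
private theorem prod_pow_pow {Γ : Type*} [CommMonoid Γ] {r : ℕ} (G : Fin r → Γ)
    (c : Fin r → ℕ) (n : ℕ) :
    (∏ i, G i ^ c i) ^ n = ∏ i, G i ^ (n * c i) := by
  rw [← Finset.prod_pow]
  exact Finset.prod_congr rfl fun i _ => by rw [← pow_mul, mul_comm]

set_option maxHeartbeats 800000 in
/-- **Values of algebraic elements are rationally dependent** (the rational rank does not grow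
in an algebraic extension; used in [CoP1] §§8–9 where `V fᵢ` chosen in `R₁ ⊆ K` form a basis
of `V′K′ ⊗ ℚ` for the finite extension `K′/K`, HAL p. 27): if the value of every element of
`S` with nonzero image is rationally dependent on `v(g₁), …, v(g_r)`, then so is the value of
every nonzero `y ∈ E` algebraic over `S` (`S → E` injective) — two terms of a vanishing
polynomial relation have the same value. [cite: CossartPiltant2008, proof of Prop. 9.3 (HAL p. 27)] -/
theorem exists_dependence_of_isAlgebraic (hinj : Function.Injective (algebraMap S E)) {r : ℕ}
    (g : Fin r → E)
    (hS : ∀ s : S, algebraMap S E s ≠ 0 → ∃ (n : ℕ) (a b : Fin r → ℕ), 0 < n ∧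
      O.valuation (algebraMap S E s) ^ n * ∏ i, O.valuation (g i) ^ b i =
        ∏ i, O.valuation (g i) ^ a i)
    (y : E) (hy0 : y ≠ 0) (hy : IsAlgebraic S y) :
    ∃ (n : ℕ) (a b : Fin r → ℕ), 0 < n ∧
      O.valuation y ^ n * ∏ i, O.valuation (g i) ^ b i = ∏ i, O.valuation (g i) ^ a i := by
  classical
  obtain ⟨P, hP0, hPy⟩ := hy
  set T : ℕ → E := fun j => algebraMap S E (P.coeff j) * y ^ j with hT
  set s : Finset ℕ := Finset.range (P.natDegree + 1) with hs
  have hsum : ∑ j ∈ s, T j = 0 := by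
    rw [← hPy, Polynomial.aeval_eq_sum_range]
    simp only [hT, hs, Algebra.smul_def]
  have hvy : O.valuation y ≠ 0 := fun h => hy0 ((Valuation.zero_iff _).mp h)
  -- the leading term has nonzero value
  have hlead : O.valuation (T P.natDegree) ≠ 0 := by
    simp only [hT, map_mul, map_pow]
    refine mul_ne_zero (fun h => ?_) (pow_ne_zero _ hvy)
    have h1 : algebraMap S E P.leadingCoeff = 0 := (Valuation.zero_iff _).mp h
    rw [← map_zero (algebraMap S E)] at h1
    exact (Polynomial.leadingCoeff_ne_zero.mpr hP0) (hinj h1)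
  have hdeg : P.natDegree ∈ s := by rw [hs]; exact Finset.self_mem_range_succ _
  -- a term of maximal value, and a second one with the same value
  obtain ⟨j₀, hj₀s, hj₀max⟩ := s.exists_max_image (fun j => O.valuation (T j)) ⟨_, hdeg⟩
  have hj₀0 : O.valuation (T j₀) ≠ 0 := fun h =>
    hlead (le_antisymm (h ▸ hj₀max _ hdeg) zero_le)
  have hex : ∃ j₁ ∈ s, j₁ ≠ j₀ ∧ O.valuation (T j₁) = O.valuation (T j₀) := by
    by_contra hne
    push Not at hne
    have hlt : ∀ j ∈ s.erase j₀, O.valuation (T j) < O.valuation (T j₀) := fun j hj => by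
      obtain ⟨hj, hjs⟩ := Finset.mem_erase.mp hj
      exact lt_of_le_of_ne (hj₀max j hjs) (hne j hjs hj)
    have h1 : O.valuation (∑ j ∈ s.erase j₀, T j) < O.valuation (T j₀) :=
      Valuation.map_sum_lt _ hj₀0 hlt
    have h2 : O.valuation (∑ j ∈ s, T j) = O.valuation (T j₀) := by
      rw [← Finset.add_sum_erase _ _ hj₀s]
      exact Valuation.map_add_eq_of_lt_left _ h1
    rw [hsum, map_zero] at h2
    exact hj₀0 h2.symm
  obtain ⟨j₁, hj₁s, hj₁0, hj₁eq⟩ := hex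
  -- order the two indices
  obtain ⟨i, j, hij, hTij, hTi0⟩ : ∃ i j : ℕ, i < j ∧ O.valuation (T i) = O.valuation (T j) ∧
      O.valuation (T i) ≠ 0 := by
    rcases lt_or_gt_of_ne hj₁0 with h | h
    · exact ⟨j₁, j₀, h, hj₁eq, by rw [hj₁eq]; exact hj₀0⟩
    · exact ⟨j₀, j₁, h, hj₁eq.symm, hj₀0⟩
  have hTj0 : O.valuation (T j) ≠ 0 := hTij ▸ hTi0
  -- the two coefficients and the relation `v(y)^{j-i} v(c_j) = v(c_i)`
  have hci : algebraMap S E (P.coeff i) ≠ 0 := fun h => by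
    apply hTi0; simp only [hT, h, zero_mul, map_zero]
  have hcj : algebraMap S E (P.coeff j) ≠ 0 := fun h => by
    apply hTj0; simp only [hT, h, zero_mul, map_zero]
  have h3 : O.valuation y ^ (j - i) * O.valuation (algebraMap S E (P.coeff j)) =
      O.valuation (algebraMap S E (P.coeff i)) := by
    have h' : O.valuation (algebraMap S E (P.coeff i)) * O.valuation y ^ i =
        (O.valuation y ^ (j - i) * O.valuation (algebraMap S E (P.coeff j))) *
          O.valuation y ^ i := by
      have := hTij
      simp only [hT, map_mul, map_pow] at this
      rw [this, show j = (j - i) + i from (Nat.sub_add_cancel hij.le).symm, pow_add]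
      simp only [Nat.add_sub_cancel, mul_comm, mul_assoc]
    exact (mul_right_cancel₀ (pow_ne_zero _ hvy) h').symm
  obtain ⟨n₁, a₁, b₁, hn₁, h1⟩ := hS (P.coeff i) hci
  obtain ⟨n₂, a₂, b₂, hn₂, h2⟩ := hS (P.coeff j) hcj
  -- notation-free bookkeeping
  set Y := O.valuation y with hY
  set Ci := O.valuation (algebraMap S E (P.coeff i)) with hCi
  set Cj := O.valuation (algebraMap S E (P.coeff j)) with hCj
  set G : Fin r → O.ValueGroup := fun k => O.valuation (g k) with hG
  refine ⟨(j - i) * (n₁ * n₂), fun k => n₂ * a₁ k + n₁ * b₂ k, fun k => n₁ * a₂ k + n₂ * b₁ k,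
    Nat.mul_pos (Nat.sub_pos_of_lt hij) (Nat.mul_pos hn₁ hn₂), ?_⟩
  change Y ^ ((j - i) * (n₁ * n₂)) * ∏ k, G k ^ (n₁ * a₂ k + n₂ * b₁ k) =
    ∏ k, G k ^ (n₂ * a₁ k + n₁ * b₂ k)
  change Ci ^ n₁ * ∏ k, G k ^ b₁ k = ∏ k, G k ^ a₁ k at h1
  change Cj ^ n₂ * ∏ k, G k ^ b₂ k = ∏ k, G k ^ a₂ k at h2
  change Y ^ (j - i) * Cj = Ci at h3
  rw [← prod_pow_mul_prod_pow G (fun k => n₁ * a₂ k) (fun k => n₂ * b₁ k),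
    ← prod_pow_mul_prod_pow G (fun k => n₂ * a₁ k) (fun k => n₁ * b₂ k),
    ← prod_pow_pow G a₂ n₁, ← prod_pow_pow G b₁ n₂, ← prod_pow_pow G a₁ n₂,
    ← prod_pow_pow G b₂ n₁, ← h1, ← h2, ← h3]
  simp only [mul_pow, ← pow_mul]
  have e1 : (j - i) * (n₁ * n₂) = (j - i) * n₁ * n₂ := by ring
  have e2 : n₂ * n₁ = n₁ * n₂ := by ring
  rw [e1, e2]
  simp only [mul_assoc, mul_comm, mul_left_comm]

end Algebraic

end Literature.AlgebraicGeometry.Resolution
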